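import Summits.QuantumFields.YangMills.Theorems.BalabanUVNodesN20FibreDomCompositionAE
import Summits.QuantumFields.YangMills.Theorems.BalabanUVNodesN21ShellSplitOfRecord13CoPHKeyed

/-!
# N20 (NE7b): THE DRESSED ONE-COMPONENT LETTERS AT EVERY SOURCE `|t| ≤ 1` AND EVERY LOOP STRING FOLLOW, ON THE LIVE LINE, FROM ONE `t`-FREE, `os`-FREE LETTER ON THE
# RECORD'S OWN UNDRESSED (2.18) SLOTS — an a.e. letter transfers under a two-sided pointwise comparison (integrability, not boundedness); n19-c's dressed ∕ vacuum sandwich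
# and vacuum identity at the live selector; the regularity rows (C) of the road-[e] faces are theorems there

Cell `pub-ymgap`, YM-PLAN Track A (HUMAN RULING D-0062); seat `pub-ymgap-dag-n20-d` (R134 (a) N20 NE7b s3 — «alternative currency»), gen 45 — director-ym №374 line (E), road [e]
TOWER-FREE of record (№377); dag-lead WORDS 499 GO.  `--kind proof --supports stmt-QuantumFields-27366 --as helper` (K3⁸); COUNT-NEUTRAL helper ∕ NOT a discharge; THEOREMS ONLY
(0 `def`).  [III] = [Balaban1988Convergent]; [LF-II] = [Balaban1989LargeFieldII]; [IV] = [Balaban1989LargeFieldI].  Cited BY NAME, nothing restated: ✓p785983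
`…N20FibreDomCompositionAE` (`lmarginal_ofReal_le_mul_ae_of_fibreIntegral_le_ae`; through it ✓p783663's `lmarginal_const_mul_fibre` and def-R's `lmarginal_ofReal_ae_ne_top`),
dag-n19-c's `…N19MGFRoadLiveSelector(Tower)` (`slotsOfRecord_eq_exp_mul_dressedSlotsOfDatum₉_zero`, `fibreIntegral_const_mul`, `dressedSlotsOfDatum₉_sandwich_of_ppSelLive`,
`measurable_dressedSlotsOfDatum₉`), dag-n21-d's `…N21ShellSplitOfRecord13CoPHKeyed` §6 (`integrable_chi_mul_dressedSlots_of_ppSelLive` — integrability of the dressed pieces on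
the live line, every level and source; its record faces `integrable_topPieceA∕B_of_liveSel` are the road-[e] faces' rows (C)), def-T ∕ K0c rows (`wOfRecord_nonneg`,
`measurable_wOfRecord_of_localBg`, `measurable_chiSeqOfRecord_of_localBg`, B1 `isPrintedAveraged_datumOfRecord₁₃CoPH`).  Companion: the face `…CeilingUndressedAE` (gen 45).

WHY (the `t`-free ∕ `os`-free currency of item (a′)).  The road-[e] faces of record (✓p786169 `…CeilingPerRegionAE`, ✓p782644 `…Ceiling`) display item (a′) — the one-component
relative letters, [LF-II] (1.79)∕(1.89) KIND read on [IV] (0.3)'s fibre — for F3's DRESSED pieces `χ(s)·dressedSlotsOfDatum₉ θ (datum) g₀ os t (run) (hist) K s` at EVERY source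
`|t| ≤ 1` and EVERY loop string `os`: one letter family per `(K, t, os)`.  Print has no dressing: [LF-II]'s letters and (B)'s §2 [III] form (`Node00.SLaw₁₃CoPH`) speak about the
record's OWN post-𝐑 (2.18) terms — def-T's `slotsOfRecord … (EOfRecord₁₃ θ) (wOfRecord₉ θ) θ.ppSel (run) (hist)`.  ON THE LIVE LINE (the tuple's residual selector IS the live
selector of record — K3⁸ v7's `LiveSel`; with (H-U) and the sign law `0 ≤ θ.ζ`) the two currencies are ONE CONSTANT apart, by two facts of dag-n19-c's lane: the record's tower
is `e^{−E p}`× F3's vacuum (`t = 0`) dressed tower EXACTLY (`slotsOfRecord_eq_exp_mul_dressedSlotsOfDatum₉_zero`; the vacuum tower does not read `os`), and F3's dressed tower at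
source `t` is sandwiched `e^{−|t|}·d⁰ ≤ dᵗ ≤ e^{|t|}·d⁰` POINTWISE at the live selector (`dressedSlotsOfDatum₉_sandwich_of_ppSelLive`; birth constants, since `|F_os| ≤ 1`).  An
a.e. fibre letter transfers under such a two-sided pointwise comparison at the cost of the product of the constants — here `e^{2|t|} ≤ e²` — provided the comparison densities
are INTEGRABLE (✓p785983's device: in `ℝ≥0∞` the inequalities compose at a.e. configuration and `toReal` loses nothing where the marginal is finite, i.e. a.e.); no boundedness
row (gen 44's located VERSION defect is not re-introduced); the integrability is dag-n21-d's theorem on the live line.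

WHAT IS PROVED (kernel; zero `sorry`).  §1 (generic, def-R's real `fibreIntegral` currency) `lmarginal_ofReal_le_mul_of_pointwise`, ★ `fibreIntegral_le_mul_ae_of_sandwich`
(`f₁ ≤ C₁·g₁`, `g₂ ≤ C₂·f₂` pointwise, `g₁, f₂` measurable + integrable, `∫⌈_s g₁ ≤ z·∫⌈_s g₂` a.e. ⇒ `∫⌈_s f₁ ≤ (C₁ z C₂)·∫⌈_s f₂` a.e.), `fibreIntegral_letter_mono_factor`.
§2 (key-blind, at a Stage-9 tuple PINNED AT THE LIVE SELECTOR; rows (H-U), `Σ|ζ| ≤ 1`, (H-ζ), `0 ≤ ζ`, `D.AvgMeasurable`, `g 0 = g₀ p.K`) ★★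
`dressedLetterAE_of_undressedLetterAE_of_ppSelLive` (for `|t| ≤ 1`: the undressed a.e. letter with factor `e^{−2}·r` ⇒ the dressed a.e. letter at `(t, os)` with factor `r`).
§3 (at the CoPH record `(θ, hP : Provisos₁₃CoPH)`, rows `hsel` + (H-U) + `0 ≤ θ.ζ`; the record's `zetaAbs ∕ zetaMeas` and B1 supply the rest) `measurable_chi_mul_dressedSlotsOfDatum₉_A ∕ _B`
(the faces' measurability rows (C), from (H-U) alone), ★★ `dressedLetterAE_of_undressedLetterAE_A ∕ _B` (both runs, top level, `E := EOfRecord₁₃ θ`).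

HONEST FRAMING.  [a.e. Fubini + bookkeeping over n19-c's sandwich]: no estimate.  NOTHING of Bałaban's is asserted; the undressed one-component letter a consumer supplies is STILL
[LF-II] (1.79)∕(1.89)-improved KIND read relatively on [IV] (0.3)'s fibre — NOT PRINTED for `d = 4` ∕ NOT proved (junction NC-NE7b-α UNRULED), object-bound (A1c); NE7 ∕ NE7b ∕
NE7c NOT proved; no `Provisos₁₃CoPH` inhabitant claimed (K0⁷ OPEN); K3⁸ untouched; N20 NOT discharged; counts UNMOVED (typed 28∕28 · discharged 8∕27); one finite four-torus
programme at fixed `ε` — NOT ℝ⁴, NOT OS, NOT a mass gap, NOT the Clay problem.  No `def`, no `instance`, no `notation`, no `sorry`; no decl below carries a cite tag.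
-/

noncomputable section

open MeasureTheory
open scoped BigOperators ENNReal
open Finset

namespace YMDAG.UVSplit

open Literature.MathematicalPhysics.QuantumFieldTheory.Balaban1983to89
open Literature.MathematicalPhysics.QuantumFieldTheory.Balaban1983to89.T4Continuum
open Literature.MathematicalPhysics.QuantumFieldTheory.Balaban1983to89.Node00
open Literature.MathematicalPhysics.QuantumFieldTheory.Balaban1983to89.B15.BasicStep (fibreIntegral ofReal_comp_measurable lmarginal_ofReal_ae_ne_top)
open Summit.QuantumFields.YangMills.BalabanUVNodes.N19MGFRoadLiveSelector (slotsOfRecord_eq_exp_mul_dressedSlotsOfDatum₉_zero fibreIntegral_const_mul)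
open Summit.QuantumFields.YangMills.BalabanUVNodes.N19MGFRoadLiveSelectorTower (dressedSlotsOfDatum₉_sandwich_of_ppSelLive measurable_dressedSlotsOfDatum₉)
open Summit.QuantumFields.YangMills.Theorems.N21ShellSplitOfRecord13CoPH (integrable_chi_mul_dressedSlots_of_ppSelLive)

/-! ## §1 An a.e. one-component letter TRANSFERS under a two-sided pointwise comparison (integrability, not boundedness) -/

section Transfer

variable {P : Params} {G : Type*} [GaugeGroup G] [MeasurableSpace G] [HaarData G] {j : ℕ}

/-- A pointwise domination `f ≤ C·g` (`0 ≤ C`) passes to the `ℝ≥0∞` fibre marginals at EVERY configuration: `∫⋯∫⁻_s ofReal∘f ≤ ofReal C · ∫⋯∫⁻_s ofReal∘g`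
(Mathlib `lmarginal_mono`, the constant is fibre-independent). [bookkeeping] -/
theorem lmarginal_ofReal_le_mul_of_pointwise {iP : DecidableEq (PBond P j)} (s : Finset (PBond P j)) {f g : Density P j G} {C : ℝ} (hC : 0 ≤ C)
    (h : ∀ U, f U ≤ C * g U) (V : GaugeField P j G) :
    (∫⋯∫⁻_s, (fun U => ENNReal.ofReal (f U)) ∂(fun _ : PBond P j => (HaarData.haar : Measure G))) V ≤
      ENNReal.ofReal C * (∫⋯∫⁻_s, (fun U => ENNReal.ofReal (g U)) ∂(fun _ : PBond P j => (HaarData.haar : Measure G))) V := by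
  have hmono : (∫⋯∫⁻_s, (fun U => ENNReal.ofReal (f U)) ∂(fun _ : PBond P j => (HaarData.haar : Measure G))) V ≤
      (∫⋯∫⁻_s, (fun U => ENNReal.ofReal C * ENNReal.ofReal (g U)) ∂(fun _ : PBond P j => (HaarData.haar : Measure G))) V :=
    lmarginal_mono (fun U => (ENNReal.ofReal_le_ofReal (h U)).trans_eq (ENNReal.ofReal_mul hC)) V
  exact hmono.trans_eq (congrFun (lmarginal_const_mul_fibre (iP := iP) s ENNReal.ofReal_ne_top fun U => ENNReal.ofReal (g U)) V)

/-- ★ **AN A.E. LETTER TRANSFERS UNDER A TWO-SIDED POINTWISE COMPARISON.**  Real densities `f₁, g₁, g₂, f₂` on one lattice, a fibre set `s`, constants `0 ≤ C₁, C₂, z`; if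
`f₁ ≤ C₁·g₁` and `g₂ ≤ C₂·f₂` pointwise, `g₁` and `f₂` are measurable and INTEGRABLE, and def-R's letter `∫⌈_s g₁ ≤ z·∫⌈_s g₂` holds `dV`-almost everywhere, then
`∫⌈_s f₁ ≤ (C₁ z C₂)·∫⌈_s f₂` holds `dV`-almost everywhere.  (In `ℝ≥0∞` the three inequalities compose at a.e. configuration — ✓`…N20FibreDomCompositionAE`'s
`lmarginal_ofReal_le_mul_ae_of_fibreIntegral_le_ae` for the middle one —, and `toReal` loses nothing where the marginal of `f₂` is finite, i.e. a.e. by integrability: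
def-R's `lmarginal_ofReal_ae_ne_top`.)  No boundedness row. [bookkeeping] -/
theorem fibreIntegral_le_mul_ae_of_sandwich {iP : DecidableEq (PBond P j)} (s : Finset (PBond P j)) {f₁ g₁ g₂ f₂ : Density P j G} {C₁ C₂ z : ℝ}
    (hC₁ : 0 ≤ C₁) (hC₂ : 0 ≤ C₂) (hz : 0 ≤ z) (hg₁ : Measurable g₁) (hg₁i : Integrable g₁ (fieldMeasure P j G)) (hf₂ : Measurable f₂)
    (hf₂i : Integrable f₂ (fieldMeasure P j G)) (h₁ : ∀ U, f₁ U ≤ C₁ * g₁ U) (h₂ : ∀ U, g₂ U ≤ C₂ * f₂ U)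
    (h : ∀ᵐ V ∂fieldMeasure P j G, fibreIntegral s g₁ V ≤ z * fibreIntegral s g₂ V) :
    ∀ᵐ V ∂fieldMeasure P j G, fibreIntegral s f₁ V ≤ C₁ * z * C₂ * fibreIntegral s f₂ V := by
  filter_upwards [lmarginal_ofReal_le_mul_ae_of_fibreIntegral_le_ae s hg₁ hg₁i hz h, lmarginal_ofReal_ae_ne_top s hf₂ hf₂i.lintegral_lt_top.ne] with V hV hfin
  set Lf₁ := (∫⋯∫⁻_s, (fun U => ENNReal.ofReal (f₁ U)) ∂(fun _ : PBond P j => (HaarData.haar : Measure G))) V with hLf₁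
  set Lg₁ := (∫⋯∫⁻_s, (fun U => ENNReal.ofReal (g₁ U)) ∂(fun _ : PBond P j => (HaarData.haar : Measure G))) V with hLg₁
  set Lg₂ := (∫⋯∫⁻_s, (fun U => ENNReal.ofReal (g₂ U)) ∂(fun _ : PBond P j => (HaarData.haar : Measure G))) V with hLg₂
  set Lf₂ := (∫⋯∫⁻_s, (fun U => ENNReal.ofReal (f₂ U)) ∂(fun _ : PBond P j => (HaarData.haar : Measure G))) V with hLf₂
  have hA : Lf₁ ≤ ENNReal.ofReal C₁ * Lg₁ := lmarginal_ofReal_le_mul_of_pointwise (iP := iP) s hC₁ h₁ V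
  have hC : Lg₂ ≤ ENNReal.ofReal C₂ * Lf₂ := lmarginal_ofReal_le_mul_of_pointwise (iP := iP) s hC₂ h₂ V
  have hchain : Lf₁ ≤ ENNReal.ofReal (C₁ * z * C₂) * Lf₂ :=
    calc Lf₁ ≤ ENNReal.ofReal C₁ * Lg₁ := hA
      _ ≤ ENNReal.ofReal C₁ * (ENNReal.ofReal z * Lg₂) := by gcongr
      _ ≤ ENNReal.ofReal C₁ * (ENNReal.ofReal z * (ENNReal.ofReal C₂ * Lf₂)) := by gcongr
      _ = ENNReal.ofReal (C₁ * z * C₂) * Lf₂ := by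
          rw [ENNReal.ofReal_mul (mul_nonneg hC₁ hz), ENNReal.ofReal_mul hC₁]; ring
  have hprod : 0 ≤ C₁ * z * C₂ := mul_nonneg (mul_nonneg hC₁ hz) hC₂
  show Lf₁.toReal ≤ C₁ * z * C₂ * Lf₂.toReal
  have hmono := ENNReal.toReal_mono (ENNReal.mul_ne_top ENNReal.ofReal_ne_top hfin) hchain
  rwa [ENNReal.toReal_mul, ENNReal.toReal_ofReal hprod] at hmono

/-- A letter with a smaller non-negative factor is a letter with a bigger one (fibre integrals are `≥ 0`). [bookkeeping] -/
theorem fibreIntegral_letter_mono_factor {iP : DecidableEq (PBond P j)} (s : Finset (PBond P j)) (f g : Density P j G) {z z' : ℝ} (hzz' : z ≤ z')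
    (V : GaugeField P j G) (h : fibreIntegral s f V ≤ z * fibreIntegral s g V) : fibreIntegral s f V ≤ z' * fibreIntegral s g V :=
  h.trans (mul_le_mul_of_nonneg_right hzz' ENNReal.toReal_nonneg)

end Transfer

/-! ## §2 Key-blind: at a Stage-9 tuple PINNED AT THE LIVE SELECTOR the dressed letters at every source follow from the undressed one -/

section KeyBlind

variable {F : T4Family} {N : ℕ} [NeZero N]
variable (ϑ : Stage9Params F N) (E : B12.RunParams → ℝ) (hsel : ϑ.ppSel = ppSelLiveOfRecord F N ϑ.ν ϑ.τ9 E (wOfRecord₉ F N ϑ))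
  (hU : LocalBgMeasurable F N ϑ.ν) (hζa : IsZetaAbsLeOne F N ϑ.ν ϑ.τ9.M ϑ.ζ) (hζm : ZetaMeasurable F N ϑ.ζ)
  (hζ0 : ∀ p g k s Pl Ql RS U V', 0 ≤ ϑ.ζ p g k s Pl Ql RS U V')
  (D : FiniteEpsData F (SU N)) (hD : D.AvgMeasurable) (g₀ : ℕ → ℝ) (os : List (ULoop F)) (p : B12.RunParams) (g : ℕ → ℝ) (hg : g 0 = g₀ p.K)

include hsel hU hζa hζm hζ0 hD hg

/-- ★★ **THE DRESSED LETTER AT SOURCE `t` FROM THE UNDRESSED LETTER, AT A LIVE-PINNED TUPLE.**  For `|t| ≤ 1`, a fibre set `S` of the top lattice, two top-level histories `s₁, s₂` and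
`0 ≤ r`: if def-R's one-component letter holds `dV`-a.e. for the UNDRESSED post-𝐑 slots `u = slotsOfRecord … E (wOfRecord₉ ϑ) ϑ.ppSel p g` with factor `e^{−2}·r` —
`∫⌈_S χ(s₁)·u(s₁) ≤ e^{−2}·r·∫⌈_S χ(s₂)·u(s₂)` — then it holds for F3's DRESSED pieces at `(t, os)` with factor `r`: `∫⌈_S χ(s₁)·dᵗ(s₁) ≤ r·∫⌈_S χ(s₂)·dᵗ(s₂)` `dV`-a.e.
(n19-c: `u = e^{−E p}·d⁰` exactly, `e^{−|t|}·d⁰ ≤ dᵗ ≤ e^{|t|}·d⁰` pointwise; §1 with the integrability of `χ·d⁰(s₁)` and `χ·dᵗ(s₂)`; `e^{2|t|}·e^{−2} ≤ 1`.) [bookkeeping] -/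
theorem dressedLetterAE_of_undressedLetterAE_of_ppSelLive {t : ℝ} (ht : |t| ≤ 1) (S : Finset (PBond (F.P p.K) p.K)) (s₁ s₂ : SeqOfRecord F ϑ.ν ϑ.τ9.M g p.K p.K)
    {r : ℝ} (hr : 0 ≤ r)
    (h : ∀ᵐ V ∂fieldMeasure (F.P p.K) p.K (SU N),
      fibreIntegral S (fun V => chiSeqOfRecord F N ϑ.ν ϑ.τ9.M g p.K p.K s₁ V * slotsOfRecord F N ϑ.ν ϑ.τ9 E (wOfRecord₉ F N ϑ) ϑ.ppSel p g p.K s₁ V) V ≤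
        Real.exp (-2) * r * fibreIntegral S (fun V => chiSeqOfRecord F N ϑ.ν ϑ.τ9.M g p.K p.K s₂ V * slotsOfRecord F N ϑ.ν ϑ.τ9 E (wOfRecord₉ F N ϑ) ϑ.ppSel p g p.K s₂ V) V) :
    ∀ᵐ V ∂fieldMeasure (F.P p.K) p.K (SU N),
      fibreIntegral S (fun V => chiSeqOfRecord F N ϑ.ν ϑ.τ9.M g p.K p.K s₁ V * dressedSlotsOfDatum₉ F N ϑ D g₀ os t p g p.K s₁ V) V ≤
        r * fibreIntegral S (fun V => chiSeqOfRecord F N ϑ.ν ϑ.τ9.M g p.K p.K s₂ V * dressedSlotsOfDatum₉ F N ϑ D g₀ os t p g p.K s₂ V) V := by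
  have hw0 : ∀ k s' U V', 0 ≤ wOfRecord₉ F N ϑ p g k s' U V' := fun k s' U V' => wOfRecord_nonneg F N ϑ.ν ϑ.τ9.M p g k ϑ.A₁ hζ0 s' U V'
  have hwm : ∀ k s', Measurable (fun z : GaugeField (F.P p.K) (k + 1) (SU N) × GaugeField (F.P p.K) k (SU N) => wOfRecord₉ F N ϑ p g k s' z.2 z.1) :=
    fun k s' => measurable_wOfRecord_of_localBg hU ϑ.τ9.M ϑ.A₁ hζm p g k s'
  have hχm : ∀ k s, Measurable (chiSeqOfRecord F N ϑ.ν ϑ.τ9.M g p.K k s) := fun k s => measurable_chiSeqOfRecord_of_localBg hU ϑ.τ9.M g p.K k s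
  -- n19-c: the dressed ∕ vacuum sandwich at the live selector; the record's tower = `e^{−E p}`× the vacuum tower
  have hsand := dressedSlotsOfDatum₉_sandwich_of_ppSelLive F N ϑ D g₀ os p g E hsel hg hD hw0 hwm hχm t p.K
  have hid := slotsOfRecord_eq_exp_mul_dressedSlotsOfDatum₉_zero F N ϑ D g₀ os E p g hg p.K
  have hχ0 := fun s V => chiSeqOfRecord_nonneg F N ϑ.ν ϑ.τ9.M g p.K p.K s V
  have hcpos : 0 < Real.exp (-E p) := Real.exp_pos _
  -- the undressed pieces are `e^{−E p}`× the vacuum dressed pieces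
  have hpiece : ∀ s : SeqOfRecord F ϑ.ν ϑ.τ9.M g p.K p.K,
      (fun V => chiSeqOfRecord F N ϑ.ν ϑ.τ9.M g p.K p.K s V * slotsOfRecord F N ϑ.ν ϑ.τ9 E (wOfRecord₉ F N ϑ) ϑ.ppSel p g p.K s V) =
        fun V => Real.exp (-E p) * (chiSeqOfRecord F N ϑ.ν ϑ.τ9.M g p.K p.K s V * dressedSlotsOfDatum₉ F N ϑ D g₀ os 0 p g p.K s V) := by
    intro s; funext V
    rw [hid s V]; ring
  -- Step 1: the vacuum letter with factor `e^{−2}·r` (the constant cancels)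
  have h0 : ∀ᵐ V ∂fieldMeasure (F.P p.K) p.K (SU N),
      fibreIntegral S (fun V => chiSeqOfRecord F N ϑ.ν ϑ.τ9.M g p.K p.K s₁ V * dressedSlotsOfDatum₉ F N ϑ D g₀ os 0 p g p.K s₁ V) V ≤
        Real.exp (-2) * r * fibreIntegral S (fun V => chiSeqOfRecord F N ϑ.ν ϑ.τ9.M g p.K p.K s₂ V * dressedSlotsOfDatum₉ F N ϑ D g₀ os 0 p g p.K s₂ V) V := by
    filter_upwards [h] with V hV
    rw [hpiece s₁, hpiece s₂, fibreIntegral_const_mul S hcpos.le _ V, fibreIntegral_const_mul S hcpos.le _ V] at hV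
    have hV' : Real.exp (-E p) * fibreIntegral S (fun V => chiSeqOfRecord F N ϑ.ν ϑ.τ9.M g p.K p.K s₁ V * dressedSlotsOfDatum₉ F N ϑ D g₀ os 0 p g p.K s₁ V) V ≤
        Real.exp (-E p) * (Real.exp (-2) * r *
          fibreIntegral S (fun V => chiSeqOfRecord F N ϑ.ν ϑ.τ9.M g p.K p.K s₂ V * dressedSlotsOfDatum₉ F N ϑ D g₀ os 0 p g p.K s₂ V) V) := by
      linarith
    exact le_of_mul_le_mul_left hV' hcpos
  -- Step 2: §1 with `χ·dᵗ(s₁) ≤ e^{|t|}·χ·d⁰(s₁)` and `χ·d⁰(s₂) ≤ e^{|t|}·χ·dᵗ(s₂)` (`χ ≥ 0`)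
  have h₁ : ∀ U, chiSeqOfRecord F N ϑ.ν ϑ.τ9.M g p.K p.K s₁ U * dressedSlotsOfDatum₉ F N ϑ D g₀ os t p g p.K s₁ U ≤
      Real.exp |t| * (chiSeqOfRecord F N ϑ.ν ϑ.τ9.M g p.K p.K s₁ U * dressedSlotsOfDatum₉ F N ϑ D g₀ os 0 p g p.K s₁ U) := fun U => by
    rw [mul_left_comm]; exact mul_le_mul_of_nonneg_left (hsand s₁ U).2 (hχ0 s₁ U)
  have h₂ : ∀ U, chiSeqOfRecord F N ϑ.ν ϑ.τ9.M g p.K p.K s₂ U * dressedSlotsOfDatum₉ F N ϑ D g₀ os 0 p g p.K s₂ U ≤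
      Real.exp |t| * (chiSeqOfRecord F N ϑ.ν ϑ.τ9.M g p.K p.K s₂ U * dressedSlotsOfDatum₉ F N ϑ D g₀ os t p g p.K s₂ U) := fun U => by
    have hd : dressedSlotsOfDatum₉ F N ϑ D g₀ os 0 p g p.K s₂ U ≤ Real.exp |t| * dressedSlotsOfDatum₉ F N ϑ D g₀ os t p g p.K s₂ U :=
      calc dressedSlotsOfDatum₉ F N ϑ D g₀ os 0 p g p.K s₂ U = Real.exp |t| * (Real.exp (-|t|) * dressedSlotsOfDatum₉ F N ϑ D g₀ os 0 p g p.K s₂ U) := by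
            rw [← mul_assoc, ← Real.exp_add, add_neg_cancel, Real.exp_zero, one_mul]
        _ ≤ Real.exp |t| * dressedSlotsOfDatum₉ F N ϑ D g₀ os t p g p.K s₂ U := mul_le_mul_of_nonneg_left (hsand s₂ U).1 (Real.exp_pos _).le
    rw [mul_left_comm]; exact mul_le_mul_of_nonneg_left hd (hχ0 s₂ U)
  have hT := fibreIntegral_le_mul_ae_of_sandwich S (Real.exp_pos |t|).le (Real.exp_pos |t|).le (mul_nonneg (Real.exp_pos _).le hr)
    ((hχm p.K s₁).mul (measurable_dressedSlotsOfDatum₉ F N ϑ D g₀ os p g hD hwm hχm 0 p.K s₁))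
    (integrable_chi_mul_dressedSlots_of_ppSelLive ϑ E hsel hU hζm hζ0 hζa D hD g₀ os hg 0 p.K s₁)
    ((hχm p.K s₂).mul (measurable_dressedSlotsOfDatum₉ F N ϑ D g₀ os p g hD hwm hχm t p.K s₂))
    (integrable_chi_mul_dressedSlots_of_ppSelLive ϑ E hsel hU hζm hζ0 hζa D hD g₀ os hg t p.K s₂) h₁ h₂ h0
  -- Step 3: `e^{|t|}·(e^{−2}·r)·e^{|t|} ≤ r` for `|t| ≤ 1`
  have hfac : Real.exp |t| * (Real.exp (-2) * r) * Real.exp |t| ≤ r := by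
    have he : Real.exp |t| * Real.exp (-2) * Real.exp |t| ≤ 1 := by
      rw [← Real.exp_add, ← Real.exp_add]
      exact Real.exp_le_one_iff.2 (by linarith)
    nlinarith
  exact hT.mono fun V hV => fibreIntegral_letter_mono_factor S _ _ hfac V hV

end KeyBlind

/-! ## §3 At the CoPH record `(θ, hP)`: both runs, rows `hsel` + (H-U) + `0 ≤ θ.ζ` (the record's `zetaAbs ∕ zetaMeas` and B1 supply the rest) -/

section Record

variable {F : T4Family} {N : ℕ} [NeZero N]
variable (θ : Stage13HParams F N) (hP : θ.Provisos₁₃CoPH F N) (K₀ : ℕ) (g₀ : ℕ → ℝ) (os : List (ULoop F))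

/-- **RUN A: the dressed pieces `χ·dᵗ` are MEASURABLE** at every level, given (H-U) only (with the record's row `zetaMeas` and B1 `isPrintedAveraged_datumOfRecord₁₃CoPH`;
n19-c's `measurable_dressedSlotsOfDatum₉`). [bookkeeping] -/
theorem measurable_chi_mul_dressedSlotsOfDatum₉_A (hU : LocalBgMeasurable F N θ.ν) (K : ℕ) (t : ℝ) (k : ℕ)
    (s : SeqOfRecord F θ.ν θ.τ9.M (histA₁₃ θ K₀ g₀ K) (K₀ + K) k) :
    Measurable fun V => chiSeqOfRecord F N θ.ν θ.τ9.M (histA₁₃ θ K₀ g₀ K) (K₀ + K) k s V *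
      dressedSlotsOfDatum₉ F N θ.toStage9Params (datumOfRecord₁₃CoPH F N θ hP) g₀ os t (runA₁₃ F K₀ g₀ K) (histA₁₃ θ K₀ g₀ K) k s V :=
  (measurable_chiSeqOfRecord_of_localBg hU θ.τ9.M (histA₁₃ θ K₀ g₀ K) (runA₁₃ F K₀ g₀ K).K k s).mul
    (measurable_dressedSlotsOfDatum₉ F N θ.toStage9Params (datumOfRecord₁₃CoPH F N θ hP) g₀ os (runA₁₃ F K₀ g₀ K) (histA₁₃ θ K₀ g₀ K)
      (isPrintedAveraged_datumOfRecord₁₃CoPH F N θ hP).avgMeasurable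
      (fun k s' => measurable_wOfRecord_of_localBg hU θ.τ9.M θ.A₁ hP.zetaMeas (runA₁₃ F K₀ g₀ K) (histA₁₃ θ K₀ g₀ K) k s')
      (fun k s => measurable_chiSeqOfRecord_of_localBg hU θ.τ9.M (histA₁₃ θ K₀ g₀ K) (runA₁₃ F K₀ g₀ K).K k s) t k s)

/-- **RUN B: the same.** [bookkeeping] -/
theorem measurable_chi_mul_dressedSlotsOfDatum₉_B (hU : LocalBgMeasurable F N θ.ν) (K : ℕ) (t : ℝ) (k : ℕ)
    (s' : SeqOfRecord F θ.ν θ.τ9.M (histB₁₃ θ K₀ g₀ K) (K₀ + K + 1) k) :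
    Measurable fun V => chiSeqOfRecord F N θ.ν θ.τ9.M (histB₁₃ θ K₀ g₀ K) (K₀ + K + 1) k s' V *
      dressedSlotsOfDatum₉ F N θ.toStage9Params (datumOfRecord₁₃CoPH F N θ hP) g₀ os t (runB₁₃ F K₀ g₀ K) (histB₁₃ θ K₀ g₀ K) k s' V :=
  (measurable_chiSeqOfRecord_of_localBg hU θ.τ9.M (histB₁₃ θ K₀ g₀ K) (runB₁₃ F K₀ g₀ K).K k s').mul
    (measurable_dressedSlotsOfDatum₉ F N θ.toStage9Params (datumOfRecord₁₃CoPH F N θ hP) g₀ os (runB₁₃ F K₀ g₀ K) (histB₁₃ θ K₀ g₀ K)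
      (isPrintedAveraged_datumOfRecord₁₃CoPH F N θ hP).avgMeasurable
      (fun k s' => measurable_wOfRecord_of_localBg hU θ.τ9.M θ.A₁ hP.zetaMeas (runB₁₃ F K₀ g₀ K) (histB₁₃ θ K₀ g₀ K) k s')
      (fun k s => measurable_chiSeqOfRecord_of_localBg hU θ.τ9.M (histB₁₃ θ K₀ g₀ K) (runB₁₃ F K₀ g₀ K).K k s) t k s')

/-- ★★ **RUN A: THE DRESSED LETTER AT SOURCE `t` FROM THE UNDRESSED LETTER ON THE RECORD'S OWN post-𝐑 SLOTS** `slotsOfRecord … (EOfRecord₁₃ θ) (wOfRecord₉ θ) θ.ppSel (runA₁₃ …)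
(histA₁₃ …)` — the family (B)'s §2 form `SLaw₁₃CoPH` speaks about —, top level `K₀ + K`, `|t| ≤ 1`, ON THE LIVE LINE (§2 at the record). [bookkeeping] -/
theorem dressedLetterAE_of_undressedLetterAE_A
    (hsel : θ.ppSel = ppSelLiveOfRecord F N θ.ν θ.τ9 (EOfRecord₁₃ F N θ.toStage13Params) (wOfRecord₉ F N θ.toStage9Params))
    (hU : LocalBgMeasurable F N θ.ν) (hζsign : ∀ p g k s Pl Ql RS U V', 0 ≤ θ.ζ p g k s Pl Ql RS U V') (K : ℕ) {t : ℝ} (ht : |t| ≤ 1)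
    (S : Finset (PBond (F.P (K₀ + K)) (K₀ + K))) (s₁ s₂ : SeqOfRecord F θ.ν θ.τ9.M (histA₁₃ θ K₀ g₀ K) (K₀ + K) (K₀ + K)) {r : ℝ} (hr : 0 ≤ r)
    (h : ∀ᵐ V ∂fieldMeasure (F.P (K₀ + K)) (K₀ + K) (SU N),
      fibreIntegral S (fun V => chiSeqOfRecord F N θ.ν θ.τ9.M (histA₁₃ θ K₀ g₀ K) (K₀ + K) (K₀ + K) s₁ V *
          slotsOfRecord F N θ.ν θ.τ9 (EOfRecord₁₃ F N θ.toStage13Params) (wOfRecord₉ F N θ.toStage9Params) θ.ppSel (runA₁₃ F K₀ g₀ K) (histA₁₃ θ K₀ g₀ K)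
            (K₀ + K) s₁ V) V ≤
        Real.exp (-2) * r * fibreIntegral S (fun V => chiSeqOfRecord F N θ.ν θ.τ9.M (histA₁₃ θ K₀ g₀ K) (K₀ + K) (K₀ + K) s₂ V *
          slotsOfRecord F N θ.ν θ.τ9 (EOfRecord₁₃ F N θ.toStage13Params) (wOfRecord₉ F N θ.toStage9Params) θ.ppSel (runA₁₃ F K₀ g₀ K) (histA₁₃ θ K₀ g₀ K)
            (K₀ + K) s₂ V) V) :
    ∀ᵐ V ∂fieldMeasure (F.P (K₀ + K)) (K₀ + K) (SU N),
      fibreIntegral S (fun V => chiSeqOfRecord F N θ.ν θ.τ9.M (histA₁₃ θ K₀ g₀ K) (K₀ + K) (K₀ + K) s₁ V *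
          dressedSlotsOfDatum₉ F N θ.toStage9Params (datumOfRecord₁₃CoPH F N θ hP) g₀ os t (runA₁₃ F K₀ g₀ K) (histA₁₃ θ K₀ g₀ K) (K₀ + K) s₁ V) V ≤
        r * fibreIntegral S (fun V => chiSeqOfRecord F N θ.ν θ.τ9.M (histA₁₃ θ K₀ g₀ K) (K₀ + K) (K₀ + K) s₂ V *
          dressedSlotsOfDatum₉ F N θ.toStage9Params (datumOfRecord₁₃CoPH F N θ hP) g₀ os t (runA₁₃ F K₀ g₀ K) (histA₁₃ θ K₀ g₀ K) (K₀ + K) s₂ V) V :=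
  dressedLetterAE_of_undressedLetterAE_of_ppSelLive θ.toStage9Params (EOfRecord₁₃ F N θ.toStage13Params) hsel hU hP.zetaAbs hP.zetaMeas hζsign
    (datumOfRecord₁₃CoPH F N θ hP) (isPrintedAveraged_datumOfRecord₁₃CoPH F N θ hP).avgMeasurable g₀ os (runA₁₃ F K₀ g₀ K) (histA₁₃ θ K₀ g₀ K)
    (histA₁₃_zero θ K₀ g₀ K) ht S s₁ s₂ hr h

/-- ★★ **RUN B: the same** at cutoff `K₀ + K + 1`. [bookkeeping] -/
theorem dressedLetterAE_of_undressedLetterAE_B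
    (hsel : θ.ppSel = ppSelLiveOfRecord F N θ.ν θ.τ9 (EOfRecord₁₃ F N θ.toStage13Params) (wOfRecord₉ F N θ.toStage9Params))
    (hU : LocalBgMeasurable F N θ.ν) (hζsign : ∀ p g k s Pl Ql RS U V', 0 ≤ θ.ζ p g k s Pl Ql RS U V') (K : ℕ) {t : ℝ} (ht : |t| ≤ 1)
    (S : Finset (PBond (F.P (K₀ + K + 1)) (K₀ + K + 1))) (s₁ s₂ : SeqOfRecord F θ.ν θ.τ9.M (histB₁₃ θ K₀ g₀ K) (K₀ + K + 1) (K₀ + K + 1)) {r : ℝ} (hr : 0 ≤ r)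
    (h : ∀ᵐ V ∂fieldMeasure (F.P (K₀ + K + 1)) (K₀ + K + 1) (SU N),
      fibreIntegral S (fun V => chiSeqOfRecord F N θ.ν θ.τ9.M (histB₁₃ θ K₀ g₀ K) (K₀ + K + 1) (K₀ + K + 1) s₁ V *
          slotsOfRecord F N θ.ν θ.τ9 (EOfRecord₁₃ F N θ.toStage13Params) (wOfRecord₉ F N θ.toStage9Params) θ.ppSel (runB₁₃ F K₀ g₀ K) (histB₁₃ θ K₀ g₀ K)
            (K₀ + K + 1) s₁ V) V ≤
        Real.exp (-2) * r * fibreIntegral S (fun V => chiSeqOfRecord F N θ.ν θ.τ9.M (histB₁₃ θ K₀ g₀ K) (K₀ + K + 1) (K₀ + K + 1) s₂ V *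
          slotsOfRecord F N θ.ν θ.τ9 (EOfRecord₁₃ F N θ.toStage13Params) (wOfRecord₉ F N θ.toStage9Params) θ.ppSel (runB₁₃ F K₀ g₀ K) (histB₁₃ θ K₀ g₀ K)
            (K₀ + K + 1) s₂ V) V) :
    ∀ᵐ V ∂fieldMeasure (F.P (K₀ + K + 1)) (K₀ + K + 1) (SU N),
      fibreIntegral S (fun V => chiSeqOfRecord F N θ.ν θ.τ9.M (histB₁₃ θ K₀ g₀ K) (K₀ + K + 1) (K₀ + K + 1) s₁ V *
          dressedSlotsOfDatum₉ F N θ.toStage9Params (datumOfRecord₁₃CoPH F N θ hP) g₀ os t (runB₁₃ F K₀ g₀ K) (histB₁₃ θ K₀ g₀ K) (K₀ + K + 1) s₁ V) V ≤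
        r * fibreIntegral S (fun V => chiSeqOfRecord F N θ.ν θ.τ9.M (histB₁₃ θ K₀ g₀ K) (K₀ + K + 1) (K₀ + K + 1) s₂ V *
          dressedSlotsOfDatum₉ F N θ.toStage9Params (datumOfRecord₁₃CoPH F N θ hP) g₀ os t (runB₁₃ F K₀ g₀ K) (histB₁₃ θ K₀ g₀ K) (K₀ + K + 1) s₂ V) V :=
  dressedLetterAE_of_undressedLetterAE_of_ppSelLive θ.toStage9Params (EOfRecord₁₃ F N θ.toStage13Params) hsel hU hP.zetaAbs hP.zetaMeas hζsign
    (datumOfRecord₁₃CoPH F N θ hP) (isPrintedAveraged_datumOfRecord₁₃CoPH F N θ hP).avgMeasurable g₀ os (runB₁₃ F K₀ g₀ K) (histB₁₃ θ K₀ g₀ K)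
    (histB₁₃_zero θ K₀ g₀ K) ht S s₁ s₂ hr h

end Record

end YMDAG.UVSplit
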